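import Literature.NumberTheory.LFunctions.NoRealZeroCertificateReplayTableCheckT
import Literature.NumberTheory.LFunctions.NoRealZeroCertificateReplayNative
import HarnessLib

/-!
# Kernel replay of the Lu–Zaman–Zhao certificates: verifying deep prime tables beyond `p ≈ 1.78·10⁶` (`prow2`)

Topic `Literature/NumberTheory/LFunctions`. The entry verifiers `entryCheck` / `entryCheckT` enclose `p^σ` through
`MI.exp SC KE 0 (r·log p)`, whose argument must stay below `1`: for primes `p > e^{1/r} ≈ 1.78·10⁶` the enclosure
`prow` returns `none` and every entry check FAILS (soundly, but uselessly — observed 2026-08-26 on the tier-21 table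
parts `P33–P46`). The compiled-evaluation file already has the remedy `prow2` (one argument halving, valid to
`p < 3·10¹²`, `prow2_sound`). This file is `NoRealZeroCertificateReplayTableCheckT.lean` with `prow2` in place of `prow`:
`entryCheckT2`, `tableCheckT2`, `entryValid_of_tableCheckT2`, **`entryValid_of_chunkT2`** (trial division still by the
primes of `table15`, `isPrimeT`, sound below `2^30` via `table15_complete`). Use it for every table part with primes
above `1.7·10⁶` (tiers 21 upper half and 22 of the `parity-realchar` heavy campaign).

## References

* W. Lu, A. Zaman, K. Zhao, *Dirichlet L-functions of quadratic characters have no exceptional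
  zeros for moduli up to 10¹⁰*, Math. Comp. (2026), arXiv:2602.03626, §2.2 and (2.3). [LuZamanZhao2026]
-/

namespace Literature.NumberTheory.LFunctions
namespace LuZamanZhao2026
namespace Replay

open Literature.Analysis.ValidatedNumerics Literature.Analysis.ValidatedNumerics.NumericsMP

/-- Soundness of the walk: on a sorted table, no listed prime `q` with `q² ≤ n` divides `n`. [folklore] -/
private theorem noDivT_sound {n : ℕ} : ∀ {T : List PRow}, (T.map PRow.p).Pairwise (· < ·) → noDivT n T = true →
    ∀ e ∈ T, e.p * e.p ≤ n → ¬ e.p ∣ n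
  | [], _, _ => by simp
  | e :: T, hs, h => by
    rw [List.map_cons, List.pairwise_cons] at hs
    unfold noDivT at h
    intro e' he' hle hdvd
    by_cases h1 : n < e.p * e.p
    · -- the walk stopped: every listed prime from here on is too large
      rcases List.mem_cons.1 he' with rfl | hm
      · omega
      · have hlt : e.p < e'.p := hs.1 e'.p (List.mem_map.2 ⟨e', hm, rfl⟩)
        have : e.p * e.p < e'.p * e'.p := Nat.mul_lt_mul'' hlt hlt
        omega
    rw [if_neg h1] at h
    by_cases h2 : n % e.p = 0
    · rw [if_pos h2] at h; exact Bool.false_ne_true h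
    rw [if_neg h2] at h
    rcases List.mem_cons.1 he' with rfl | hm
    · exact h2 (Nat.mod_eq_zero_of_dvd hdvd)
    · exact noDivT_sound hs.2 h e' hm hle hdvd

/-- **`isPrimeT` is sound below `B²` over a valid table complete below `B`.** [folklore] -/
private theorem prime_of_isPrimeT {T : List PRow} (hT : TableValid T) {B : ℕ} (hc : CompleteBelow T B) {n : ℕ}
    (hn : n < B * B) (h : isPrimeT T n = true) : n.Prime := by
  unfold isPrimeT at h
  rw [Bool.and_eq_true, decide_eq_true_eq] at h
  obtain ⟨h2, hwalk⟩ := h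
  rw [Nat.prime_def_le_sqrt]
  refine ⟨h2, fun m hm2 hms hmdvd => ?_⟩
  -- a prime factor `q` of `m` divides `n` and has `q² ≤ n`
  obtain ⟨q, hq, hqm⟩ := Nat.exists_prime_and_dvd (show m ≠ 1 by omega)
  have hqn : q ∣ n := dvd_trans hqm hmdvd
  have hqle : q ≤ m := Nat.le_of_dvd (by omega) hqm
  have hmm : m * m ≤ n := Nat.le_sqrt.1 hms
  have hqq : q * q ≤ n := le_trans (Nat.mul_le_mul hqle hqle) hmm
  -- `q < B`, so `q` is listed
  have hqB : q < B := by
    by_contra hge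
    rw [not_lt] at hge
    have : B * B ≤ q * q := Nat.mul_le_mul hge hge
    omega
  obtain ⟨e, he, hep⟩ := List.mem_map.1 (hc q hq hqB)
  exact noDivT_sound hT.2 hwalk e he (by rw [hep]; exact hqq) (by rw [hep]; exact hqn)

/-- Kernel check of ONE literal table entry, deep variant: `p < 2^30`, `p` prime (`isPrimeT table15`), and the three
stored naturals below the kernel's own lower bounds computed by `prow2`. [cite: LuZamanZhao2026, §2.2 and (2.3)] -/
def entryCheckT2 (R : MI) (e : PRow) : Bool :=
  decide (e.p < 1073741824) && isPrimeT table15 e.p &&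
    match prow2 R e.p with
    | some (A, B, C) =>
      decide ((e.tPlus : ℤ) ≤ A.lo) && decide ((e.tZero : ℤ) ≤ B.lo) && decide ((e.tMinus : ℤ) ≤ C.lo)
    | none => false

/-- Kernel check of a literal table chunk with `entryCheckT2`. [cite: LuZamanZhao2026, §2.2 and (2.3)] -/
def tableCheckT2 (R : MI) : List PRow → Bool
  | [] => true
  | e :: T => entryCheckT2 R e && tableCheckT2 R T

/-- A `T2`-checked entry is valid. [cite: LuZamanZhao2026, §2.2 and (2.3)] -/
theorem entryValid_of_entryCheckT2 {R : MI} (hR : MI.mem SC (rOf 1.6) R) {e : PRow}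
    (h : entryCheckT2 R e = true) : EntryValid e := by
  unfold entryCheckT2 at h
  rw [Bool.and_eq_true, Bool.and_eq_true, decide_eq_true_eq] at h
  obtain ⟨⟨hlt, hpr⟩, h2⟩ := h
  have hprime : e.p.Prime :=
    prime_of_isPrimeT table15_valid table15_complete (B := 32768) (by norm_num at hlt ⊢; omega) hpr
  refine ⟨hprime, ?_⟩
  split at h2
  · rename_i A B C hABC
    simp only [Bool.and_eq_true, decide_eq_true_eq] at h2
    obtain ⟨⟨ha, hb⟩, hc⟩ := h2
    obtain ⟨hA, hB, hC⟩ := prow2_sound hR hprime.two_le hABC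
    refine ⟨?_, ?_, ?_⟩
    · calc (e.tPlus : ℝ) = ((e.tPlus : ℤ) : ℝ) := by push_cast; rfl
        _ ≤ (A.lo : ℝ) := by exact_mod_cast ha
        _ ≤ _ := hA.1
    · calc (e.tZero : ℝ) = ((e.tZero : ℤ) : ℝ) := by push_cast; rfl
        _ ≤ (B.lo : ℝ) := by exact_mod_cast hb
        _ ≤ _ := hB.1
    · calc (e.tMinus : ℝ) = ((e.tMinus : ℤ) : ℝ) := by push_cast; rfl
        _ ≤ (C.lo : ℝ) := by exact_mod_cast hc
        _ ≤ _ := hC.1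
  · exact absurd h2 Bool.false_ne_true

/-- A `T2`-checked table chunk has valid entries. [cite: LuZamanZhao2026, §2.2 and (2.3)] -/
theorem entryValid_of_tableCheckT2 {R : MI} (hR : MI.mem SC (rOf 1.6) R) :
    ∀ {T : List PRow}, tableCheckT2 R T = true → ∀ e ∈ T, EntryValid e
  | [], _ => by simp
  | e :: T, h => by
    unfold tableCheckT2 at h
    rw [Bool.and_eq_true] at h
    intro e' he'
    rcases List.mem_cons.1 he' with rfl | hm
    · exact entryValid_of_entryCheckT2 hR h.1
    · exact entryValid_of_tableCheckT2 hR h.2 e' hm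

/-- Entrywise validity of a table chunk from its `T2`-check in the `match rI` form used by the table files.
[cite: LuZamanZhao2026, §2.2 and (2.3)] -/
theorem entryValid_of_chunkT2 {T : List PRow}
    (h : (match rI with | some R => tableCheckT2 R T | none => false) = true) : ∀ e ∈ T, EntryValid e := by
  split at h
  · rename_i R hR
    exact entryValid_of_tableCheckT2 (mem_rI hR) h
  · exact absurd h Bool.false_ne_true

end Replay
end LuZamanZhao2026
end Literature.NumberTheory.LFunctions
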